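import Summits.ResolutionOfSingularities.ResolutionOfSingularities.Theorems.MarkedTransferCampaignW31FiniteRangeOfDictionary
import Summits.ResolutionOfSingularities.ResolutionOfSingularities.Theorems.MarkedTransferCampaignW31UscModuloHasseStable
import Literature.AlgebraicGeometry.Hironaka2017.Proofs.S04CharAlgebra.U19p2
import Literature.AlgebraicGeometry.Hironaka2017.S04CharAlgebra.R005bEdgeData
import HarnessLib

/-!
# [OURS · L1 W3.1] `CampaignW31.EdgeDataExist` from the typed candidate Rem. 4.10 (existence clause), and (iii)
# `CampaignW31EdgeHilbFiniteRange p` MODULO the dictionary (ii) and `S04CharAlgebra.Rem4_10_exists` (seat res-L1-s31-pv-2)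

Cell `res-hironaka`, rung L, slot W3.1. Sequel of `MarkedTransferCampaignW31FiniteRangeOfDictionary.lean` (p479095:
`CampaignW31EdgeHilbDictionary p → (∀ …, ∃ n, EdgeDataExist p n E edgeDataProvenance) → CampaignW31EdgeHilbFiniteRange p`). The
existence hypothesis is the typed CANDIDATE `S04CharAlgebra.Rem4_10_exists p f E` (Rem. 4.10 p.21 l.4–7 «Given ξ ∈ Sing(E)_cl …
we can choose …», row 005 part b; discharge-lane item Q-04-009) read at the uniform `n = dim Z`: at every closed point of the
ambient scheme `max(O_ξ)` needs exactly `dim Z` generators and `O_ξ` is regular (`EdgeCone.spanFinrank_maximalIdeal_eq_of_isAmbient`,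
p474045). Hence:

* `CampaignW31.edgeDataExist_of_rem4_10_exists` — `Rem4_10_exists p A.hom E → ∃ n, EdgeDataExist p n E edgeDataProvenance`
  (for `E` standard on an ambient datum over a perfect field);
* `campaignW31EdgeHilbFiniteRange_of_dictionary_of_rem4_10_exists` — **(iii) ⟸ (ii) ∧ Rem4_10_exists**, NO finite generation;
* `campaignW31EdgeHilbFiniteRange_of_U19_4_R2_of_rem4_10_exists` — with (ii) supplied by seat res-L1-s31-pv-3's
  `campaignW31EdgeHilbDictionary_of_U19_4_R2` (p478382 + `…UscModuloHasseStable.lean`): **(iii) MODULO EXACTLY the two typed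
  candidates `S04CharAlgebra.U19_4_R2` (§4.1 (8) p.19 l.31–32, Hasse–Schmidt reading; D-lane Q-04-038) and
  `S04CharAlgebra.Rem4_10_exists` (Q-04-009)**.

HONEST FRAMING. `Rem4_10_exists` is a typed CANDIDATE of the manuscript, consumed here ONLY as a hypothesis; NOTHING of H.
Hironaka's manuscript [Hironaka2017] is asserted. AI bookkeeping; weaker than expert review.
-/

set_option linter.dupNamespace false -- mandated namespace of this single-conjunct summit

open _root_.AlgebraicGeometry _root_.TopologicalSpace IsLocalRing

namespace Summit.ResolutionOfSingularities.ResolutionOfSingularities.Theorems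

open Literature.AlgebraicGeometry.Resolution
open Literature.AlgebraicGeometry.Hironaka2017
open Literature.AlgebraicGeometry.Hironaka2017.S02Preliminaries
open Literature.AlgebraicGeometry.Hironaka2017.S04CharAlgebra

universe u

namespace CampaignW31

variable {p : ℕ} [Fact p.Prime] {K : Type u} [Field K] [CharP K p] [PerfectField K]

/-- **Edge data with the Def. 4.9 provenance exist along `Sing(E)_cl` (typed OURS `EdgeDataExist`, for `n = dim Z`) from the
typed candidate Rem. 4.10** (`S04CharAlgebra.Rem4_10_exists p A.hom E`, consumed as a hypothesis): at every closed point of the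
ambient scheme `O_ξ` is regular with `μ(max O_ξ) = dim Z` (`EdgeCone.spanFinrank_maximalIdeal_eq_of_isAmbient`). NOT a statement
of the manuscript. [folklore] -/
theorem edgeDataExist_of_rem4_10_exists (A : AmbientDatum p K) (E : IdealExponent A.Z) (hE : E.IsStandard)
    (h : Rem4_10_exists p A.hom E) : ∃ n : ℕ, EdgeDataExist p n E edgeDataProvenance := by
  by_cases hne : (E.sing ∩ S02Preliminaries.closedPoints A.Z).Nonempty
  · obtain ⟨ξ₀, hξ₀⟩ := hne
    have hA : IsAmbient p A.hom := ⟨(Fact.out : p.Prime).pos, A.irreducible, A.smooth, A.quasiCompact⟩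
    haveI := A.smooth
    haveI := A.irreducible
    haveI : IsLocallyNoetherian A.Z := LocallyOfFiniteType.isLocallyNoetherian A.hom
    obtain ⟨n, hn⟩ := exists_nat_cast_eq_ringKrullDim (R := A.Z.presheaf.stalk ξ₀)
    have hdim : topologicalKrullDim A.Z = n := by
      haveI : IsReduced A.Z := isReduced_of_smooth A.hom
      haveI : IsIntegral A.Z := isIntegral_of_irreducibleSpace_of_isReduced A.Z
      rw [← ringKrullDim_stalk_eq_of_isClosed A.hom hξ₀.2, hn]
    refine ⟨n, fun ξ hξ => ?_⟩
    obtain ⟨hreg, hsf⟩ := EdgeCone.spanFinrank_maximalIdeal_eq_of_isAmbient hA hξ.2 hdim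
    exact h hA ‹PerfectField K› hE ξ hξ.1 hξ.2 hreg n hsf
  · exact ⟨0, fun ξ hξ => absurd ⟨ξ, hξ⟩ hne⟩

end CampaignW31

open CampaignW31

/-- **[OURS · L1 W3.1] (iii) `CampaignW31EdgeHilbFiniteRange p` MODULO the dictionary (ii) and the typed candidate
`S04CharAlgebra.Rem4_10_exists`** (existence of Def. 4.9 edge data at closed points of `Sing(E)`; Rem. 4.10 p.21 l.4–7) — no
finite-generation input. NOT a statement of the manuscript. [folklore] -/
theorem campaignW31EdgeHilbFiniteRange_of_dictionary_of_rem4_10_exists (p : ℕ) [Fact p.Prime]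
    (hdict : CampaignW31EdgeHilbDictionary.{u} p)
    (hrem : ∀ (K : Type u) [Field K] [CharP K p] (Z : Scheme.{u}) (f : Z ⟶ Spec (.of K)) (E : IdealExponent Z),
      Rem4_10_exists p f E) :
    CampaignW31EdgeHilbFiniteRange.{u} p :=
  campaignW31EdgeHilbFiniteRange_of_dictionary p hdict fun K _ _ _ A E hE =>
    edgeDataExist_of_rem4_10_exists A E hE (hrem K A.Z A.hom E)

/-- **[OURS · L1 W3.1] (iii) `CampaignW31EdgeHilbFiniteRange p` MODULO the two typed candidates `U19_4_R2` and `Rem4_10_exists`**: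
the dictionary from `U19_4_R2` (seat res-L1-s31-pv-3, `campaignW31EdgeHilbDictionary_of_U19_4_R2`), edge-data existence from
`Rem4_10_exists`, finiteness by `campaignW31EdgeHilbFiniteRange_of_dictionary` (no finite generation). Both candidates are
HYPOTHESES; NOTHING of the manuscript is asserted. [folklore] -/
theorem campaignW31EdgeHilbFiniteRange_of_U19_4_R2_of_rem4_10_exists (p : ℕ) [Fact p.Prime]
    (hG : ∀ (K : Type u) [Field K] [CharP K p] [PerfectField K] (A : AmbientDatum p K) (E : IdealExponent A.Z),
      U19_4_R2 p A.hom E)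
    (hrem : ∀ (K : Type u) [Field K] [CharP K p] (Z : Scheme.{u}) (f : Z ⟶ Spec (.of K)) (E : IdealExponent Z),
      Rem4_10_exists p f E) :
    CampaignW31EdgeHilbFiniteRange.{u} p :=
  campaignW31EdgeHilbFiniteRange_of_dictionary_of_rem4_10_exists p (campaignW31EdgeHilbDictionary_of_U19_4_R2 p hG) hrem

end Summit.ResolutionOfSingularities.ResolutionOfSingularities.Theorems
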